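import Summits.HubbardSuperconductivity.HubbardSuperconductivity.Theorems.AnisotropyChordTransferFibre3N1RowObjJ
import Summits.HubbardSuperconductivity.HubbardSuperconductivity.Theorems.AnisotropyChordTransferFibre3N1RowCheckC
import Summits.HubbardSuperconductivity.HubbardSuperconductivity.Theorems.AnisotropyChordTransferFibre3N1RowTrueVecBase
import Summits.HubbardSuperconductivity.HubbardSuperconductivity.Theorems.AnisotropyChordTransferFibre3ManifoldBand
import Summits.HubbardSuperconductivity.HubbardSuperconductivity.Theorems.AnisotropyChordTransferFibre3N1Identity
import Summits.HubbardSuperconductivity.HubbardSuperconductivity.Theorems.AnisotropyChordTransferFibre3G2OneLoop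
import Summits.HubbardSuperconductivity.HubbardSuperconductivity.Theorems.AnisotropyChordTransferFibre3C0Layer
import Summits.HubbardSuperconductivity.HubbardSuperconductivity.Theorems.AnisotropyChordTransferFibre3PiFourier
import Summits.HubbardSuperconductivity.HubbardSuperconductivity.Theorems.AnisotropyChordTransferFibre3OneLoopCross

/-!
# Route `AnisotropyChord` / H0 rotor rung, LEVEL 2 row `N₁`: ★★★ a PASSING CELL CHECK bounds the trial gap for ALL `L ≥ 128`

The composition of the whole Level-2 `N₁` pipeline (p2 g4–g5, on p1's PartN41-B layer): if the corrected kernel cell check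
`n1CellCheckC c a₁ a₂ 2 cmin (prec, iters) = true` and the cell's named-sum certificate `c.check = true` both hold, then for EVERY
`L ≥ 128` and EVERY ground two-magnon profile `(Δ, λ₂, f)` (`0 ≤ Δ < 1`) whose cell variables lie in the cell
(`ν = λ₂/θ² ∈ [n₁/νd, n₂/νd]`, `a = Δf(x̂) ∈ [a₁, a₂]`):  `cmin · U ≤ N₁`  (`U = 3V²T⁺`, `N₁ = trialGapN1`), i.e. the (KT-1″) trial-gap
bound `TrialGapAbs` at that `(L, Δ)` with constant `cmin` — ★★★ `trialGap_of_cellCheck`.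
Chain: `pmem_xTrue` (box bridge) + `xTrue_specs_ground` (all 105 staged specs) + the five object theorems `bHat_mem`, `pHat_mem`,
`aHat_mem`, `q1Hat_mem`, `j1Hat_mem` ⇒ `n1CellCheckC_sound` ⇒ `cmin·U′(y) ≤ N₁′(y)` at the true final vector; and the exact
normalisation `N₁ = N₁′/(4π²t)`, `U = U′/(4π²t)` from `n1Identity_holds`, `g2OneLoopForm_holds`, `sum_piR_C0fn` (`T⁺ = 3λ₂ + Q/P`)
and the one-loop Fourier forms `btermOneLoop_holds`, `piNormOneLoop_holds`, `axhatOneLoop_holds`, `piC0OneLoop_holds`,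
`bcOneLoop_holds` (p1).  The regime facts come from `ManifoldA.manifold_band`/`nu_ceiling`, `lam2_pos`, `two_lam2_lt_eps1`.
Prover seat `hubbard-h0-rotor-p2` g5; helper for piece A = stmt-HubbardSuperconductivity-23918 of rung 19089
(`--supports`, helper class).  WHAT THIS IS NOT: nothing here proves superconductivity in the Hubbard model, nor the crux itself:
it reduces `TrialGapAbs L Δ cmin` for all `L ≥ 128` to finitely many kernel cell checks over the `(ν, a)` region of the ground
manifold (the tiling is the next file); the rotor TARGET as originally worded stays FALSE (g15 verdict).  Mathlib + the tree only;
no sorry.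
-/

set_option linter.dupNamespace false
set_option autoImplicit false

open Literature.Analysis.ValidatedNumerics

namespace Summit.HubbardSuperconductivity.HubbardSuperconductivity.Theorems.AnisotropyChord.Transfer.Fibre3.L2.N1

variable (L : ℕ) [NeZero L]

/-- a direction sum of momentum sums is the momentum sum of the direction sum (four directions). -/
theorem nn_sum_swap (g : Tor L → Tor L → ℝ) (V : ℝ) :
    ((nnList L).map (fun e => (∑ k : Tor L, g e k) / V)).sum = (∑ k : Tor L, ((nnList L).map (fun e => g e k)).sum) / V := by
  simp only [nnList, List.map_cons, List.map_nil, List.sum_cons, List.sum_nil, add_zero, Finset.sum_add_distrib]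
  ring

/-- the values of the final vector at the true data. -/
theorem finalVec_vals (X : ℕ → ℝ) (v0 v1 v2 v3 v4 : ℝ) :
    let y := finalVec X [v0, v1, v2, v3, v4]
    y 0 = X 0 ∧ y 1 = X 1 ∧ y 2 = X 2 ∧ y 3 = X 3 ∧ y 4 = X 16 ∧ y 5 = v0 ∧ y 6 = v1 ∧ y 7 = v2 ∧ y 8 = v3 ∧ y 9 = v4 := by
  simp [finalVec]

/-- ★★★ **A PASSING (corrected) CELL CHECK GIVES THE TRIAL-GAP BOUND FOR EVERY `L ≥ 128` ON THE CELL.** -/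
theorem trialGap_of_cellCheck (c : L2.NamedCell) (a1 a2 cmin : ℚ) (pi : ℕ × ℕ)
    (hchk : n1CellCheckC c a1 a2 2 cmin pi = true) (hc : c.check = true) (hL : 128 ≤ L)
    {Δ lam2 : ℝ} {f : Tor L → ℝ} (hΔ0 : 0 ≤ Δ) (hΔ1 : Δ < 1) (hf : IsGroundTwoMagnon L Δ lam2 f)
    (hν1 : (c.n1 : ℝ) / c.νd ≤ lam2 / (2 * Real.pi / L) ^ 2) (hν2 : lam2 / (2 * Real.pi / L) ^ 2 ≤ (c.n2 : ℝ) / c.νd)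
    (ha1 : ((a1 : ℚ) : ℝ) ≤ Δ * f (K1 L)) (ha2 : Δ * f (K1 L) ≤ ((a2 : ℚ) : ℝ)) :
    (cmin : ℝ) * Uunit L Δ f ≤ trialGapN1 L Δ f := by
  classical
  set X := xTrue L Δ lam2 f (Δ * f (K1 L)) with hXdef
  set θ : ℝ := 2 * Real.pi / L with hθ
  have hLpos : (0 : ℝ) < L := by exact_mod_cast (show 0 < L by omega)
  have hπ := Real.pi_pos
  have hθpos : 0 < θ := by positivity
  have ht0 : 0 < θ ^ 2 := by positivity
  -- regime facts
  have hlam : 0 < lam2 := lam2_pos L (by omega) hΔ1 hf.1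
  have h2 : 2 * lam2 < eps1 L := two_lam2_lt_eps1 L (by omega) hΔ0 hf
  obtain ⟨ha0, haV, _, _⟩ := ManifoldA.manifold_band L hL hΔ0 hΔ1 hf
  have hνc := ManifoldA.nu_ceiling L hL hΔ0 hf
  have hν4 : lam2 / (2 * Real.pi / L) ^ 2 < 4 / Real.pi ^ 2 := by
    rw [div_lt_iff₀ ht0]
    have hπ2 : Real.pi ^ 2 < 10 := by nlinarith [Real.pi_lt_d2, Real.pi_pos]
    have : (0.031 : ℝ) ≤ 4 / Real.pi ^ 2 := by rw [le_div_iff₀ (by positivity)]; nlinarith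
    nlinarith
  have hV1 : (1 : ℝ) / (L : ℝ) ^ 2 = θ ^ 2 * (4 * Real.pi ^ 2)⁻¹ := by
    rw [hθ]; field_simp; ring
  have hu' : 0 < 1 - Δ * f (K1 L) + Δ * f (K1 L) * ((2 * Real.pi / L) ^ 2 * (4 * Real.pi ^ 2)⁻¹) := by
    rw [← hθ, ← hV1]; nlinarith
  obtain ⟨_, _, d3, _, d5, _, d7⟩ := ManifoldA.manifold_dictionary L (by omega) hΔ0 hΔ1 hf
  have hu : 0 < cS L Δ lam2 f * Gzero L lam2 := by
    rw [← Gres_zero_zero_eq_Gzero, d5]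
    have : 1 - Δ * f (K1 L) + Δ * f (K1 L) / (L : ℝ) ^ 2
        = 1 - Δ * f (K1 L) + Δ * f (K1 L) * ((2 * Real.pi / L) ^ 2 * (4 * Real.pi ^ 2)⁻¹) := by
      rw [← hθ, ← hV1]; ring
    rw [this]; exact hu'
  -- the interval layer
  have hPM : PMem (c.box a1 a2) X := pmem_xTrue c hc a1 a2 L hL Δ lam2 f _ hν1 hν2 ha1 ha2
  have hsp := xTrue_specs_ground L Δ lam2 f (by omega) hΔ0 hΔ1 hf hlam h2 hν4 ha0 hu'
  set vB : ℝ := ((2 * Real.pi / L) ^ 2) ^ 3 * ∑ k : Tor L, F2 L f k ^ 2 * F2 L f (k + K1 L) with hvB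
  set vP : ℝ := ((2 * Real.pi / L) ^ 2) ^ 3 * ∑ k : Tor L, F2 L f k ^ 3 with hvP
  set vA : ℝ := ((2 * Real.pi / L) ^ 2) ^ 2 * ∑ k : Tor L, F2 L f k ^ 2 * cosx L k with hvA
  set vQ : ℝ := ((2 * Real.pi / L) ^ 2) ^ 2 * ∑ k : Tor L, nK L f k * F2 L f k with hvQ
  set vJ : ℝ := ((2 * Real.pi / L) ^ 2) ^ 2 * ∑ k : Tor L, bcJ L f k with hvJ
  have oB := bHat_mem L Δ lam2 f (by omega) hΔ0 hΔ1 hf hlam h2 hu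
  have oP := pHat_mem L Δ lam2 f (by omega) hΔ0 hΔ1 hf hlam h2 hu
  have oA := aHat_mem L Δ lam2 f (by omega) hΔ0 hΔ1 hf hlam h2 hu
  have oQ := q1Hat_mem L Δ lam2 f (by omega) hΔ0 hΔ1 hf hlam h2 hu
  have oJ := j1Hat_mem L Δ lam2 f (by omega) hΔ0 hΔ1 hf hlam h2 hu
  have hob : ∀ j (hj : j < (objSpecsC 2).length) (hj' : j < [vB, vP, vA, vQ, vJ].length),
      ((objSpecsC 2)[j].1).eval X ≤ [vB, vP, vA, vQ, vJ][j] ∧ [vB, vP, vA, vQ, vJ][j] ≤ ((objSpecsC 2)[j].2).eval X := by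
    intro j hj hj'
    have hj5 : j < 5 := by simpa [objSpecsC] using hj
    interval_cases j
    · simpa [objSpecsC] using oB
    · simpa [objSpecsC] using oP
    · simpa [objSpecsC] using oA
    · simpa [objSpecsC] using oQ
    · simpa [objSpecsC] using oJ
  obtain ⟨hP1, hU1, hM⟩ := n1CellCheckC_sound c a1 a2 2 cmin pi hchk specsVarsOkC_two X hPM hsp [vB, vP, vA, vQ, vJ] rfl hob
  obtain ⟨y0, y1, y2, y3, y4, y5, y6, y7, y8, y9⟩ := finalVec_vals X vB vP vA vQ vJ
  set y := finalVec X [vB, vP, vA, vQ, vJ] with hy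
  -- coordinates of `X`
  have hX0 : X 0 = θ ^ 2 := xTrue_zero L Δ lam2 f _
  have hX1 : X 1 = Real.pi ^ 2 := by rw [hXdef, xTrue_lt16 L Δ lam2 f _ (by norm_num)]; rfl
  have hX2 : X 2 = lam2 / θ ^ 2 := by rw [hXdef, xTrue_lt16 L Δ lam2 f _ (by norm_num)]; rfl
  have hX3 : X 3 = Δ * f (K1 L) := by rw [hXdef, xTrue_lt16 L Δ lam2 f _ (by norm_num)]; rfl
  have hX16 : X 16 = eps1 L / θ ^ 2 := by rw [hXdef, xTrue_16]; rfl
  rw [y6] at hP1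
  have hvP0 : 0 < vP := by linarith
  -- the assembly expressions at `y`
  have eN : N1pE.eval y = -(6 * y 4 * y 5) + 9 * y 8 * y 5 * (y 6)⁻¹
      - 1 / 2 * y 4 * y 0 * (3 * y 2 * y 6 + -(3 / 2 * y 8) + 12 * (y 3 * (y 3 + y 1 * y 2)) * y 7) - 3 * y 9 := by
    simp only [N1pE, rsum, RExpr.eval, cst, fE1, fB, fQ, fP, fT, fNu, fA, fPi2, fAx, fJ]; push_cast; ring
  have eU : UpE.eval y = 192 * (y 1) ^ 3 * (3 * y 2 - 3 / 2 * y 8 * (y 6)⁻¹) := by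
    simp only [UpE, cube, RExpr.eval, cst, fPi2, fNu, fQ, fP]; push_cast; ring
  -- the true `N₁` and `U`
  have heven : ∀ r : Tor L, f (-r) = f r := hf.2.1
  have hswap : ∀ r : Tor L, f (r.2, r.1) = f r := ground_swap L (by omega) hf
  have hN1 := n1Identity_holds L Δ lam2 f hf.1
  have hG2 := g2OneLoopForm_holds L (by omega) Δ lam2 f hf.1 heven hswap
  have hQP := sum_piR_C0fn L hf.1
  have hPf := piNormOneLoop_holds L f heven
  have hBf := btermOneLoop_holds L f heven
  have hAf := axhatOneLoop_holds L f heven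
  have hQf := piC0OneLoop_holds L Δ lam2 f hf.1 heven
  have hCf := bcOneLoop_holds L Δ lam2 f hf.1 heven
  rw [nn_sum_swap] at hQf hCf
  -- express everything through the hatted values
  have hV : ((L : ℝ) ^ 2) = 4 * Real.pi ^ 2 / θ ^ 2 := by rw [hθ]; field_simp; ring
  have eP : PiNormSq L f = vP / (θ ^ 4 * (4 * Real.pi ^ 2)) := by
    rw [hPf, hvP, hV, ← hθ]; field_simp
  have eB : Bterm L f = 6 * vB / (θ ^ 4 * (4 * Real.pi ^ 2)) := by
    rw [hBf, hvB, hV, ← hθ]; field_simp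
  have eA : Axhat L f = vA / (θ ^ 2 * (4 * Real.pi ^ 2)) := by
    rw [hAf, hvA, hV, ← hθ]; unfold cosx; field_simp
  have eQ : ∑ cc : Cfg L, piR L f cc * C0fn L Δ lam2 f cc = -(3 / 2) * vQ / (θ ^ 2 * (4 * Real.pi ^ 2)) := by
    rw [hQf, hvQ, hV, ← hθ]; unfold nK
    simp only [List.sum_map_mul_right]
    field_simp
  have eC : BCterm L Δ lam2 f = -3 * vJ / (θ ^ 2 * (4 * Real.pi ^ 2)) := by
    rw [hCf, hvJ, hV, ← hθ]; unfold bcJ bcSummand; field_simp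
  have hPpos : 0 < PiNormSq L f := by rw [eP]; positivity
  have hT : Tplus L Δ f = 3 * lam2 + (∑ cc : Cfg L, piR L f cc * C0fn L Δ lam2 f cc) / PiNormSq L f := by
    rw [hQP]; field_simp; ring
  have hNval : trialGapN1 L Δ f = N1pE.eval y / (4 * Real.pi ^ 2 * θ ^ 2) := by
    rw [eN, y0, y1, y2, y3, y4, y5, y6, y7, y8, y9, hX0, hX1, hX2, hX3, hX16, ← d7, ← d3, hN1, hG2, hT, eQ, eP, eB, eA, eC]
    field_simp
    ring
  have hUval : Uunit L Δ f = UpE.eval y / (4 * Real.pi ^ 2 * θ ^ 2) := by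
    unfold Uunit
    rw [eU, y1, y2, y6, y8, hX1, hX2, hT, eQ, eP, hV]
    field_simp
    ring
  rw [hNval, hUval, mul_div_assoc']
  exact div_le_div_of_nonneg_right hM (by positivity)

end Summit.HubbardSuperconductivity.HubbardSuperconductivity.Theorems.AnisotropyChord.Transfer.Fibre3.L2.N1
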